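import Summits.ResolutionOfSingularities.ResolutionOfSingularities.Theorems.FrobeniusLadderFInjectiveMacaulayficationCINewtonChartHon
import Summits.ResolutionOfSingularities.ResolutionOfSingularities.Theorems.FrobeniusLadderFInjectiveMacaulayficationFHalfRowOfWeaklyNondegenerateAnyField
import HarnessLib

/-!
# (A4) ★★★ THE CI CLASS ROW: the point floor of a prime, geometrically Newton-non-degenerate COMPLETE INTERSECTION with isolated vertex is CURED, given toric cover data
# (crux `FInjectiveMacaulayfication` stmt-ResolutionOfSingularities-15315, chain w45a; res-L1-w45a-plan-1 RULINGs R23.2 (4)(ii) / R23.3 (A4) GO; seat res-L1-w45a-stub-2 g12; the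
# `r`-equation twins of ✓ `FHalfRowAnyField.{affineBlowup_fullCl_over_of_geomWeaklyNondegenerate, affineBlowup_fullCl_of_geomWeaklyNondegenerate, fHalfRow_of_geomWeaklyNondegenerate}`
# over (A3) ✓ `CINewtonChartHon.hon_of_geomCINondegenerate` — GAP-2 member «NON-HYPERSURFACE» at class level)

[OURS · L1 W4.5a] Support file (`--supports stmt-ResolutionOfSingularities-15315 --as helper`); def-free; UNCONDITIONAL (the toric cover is explicit data, the F-108 «F-TC» currency for a
fan refining EVERY `Σ_{F_l}` ∧ `Σ(𝔪)`); no named fact; NOT a statement of any manuscript; replaces the role of NO printed item. Nothing of the crux is proved. AI-written (AI review weaker than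
expert review).

SETTING. `k` ANY field of characteristic `p`, `K ⊇ k` algebraically closed; `F₀, …, F_{r−1} ∈ k[X₀..X_{n−1}]` (`n ≥ 1`) generating a PRIME ideal, GEOMETRICALLY CI-Newton-non-degenerate
along every positive weight (`CINondegenerate.IsCINondegenerateAlong` for `map (algebraMap k K) ∘ F`), no variable in `(F)` (`hXne`), `X = Spec k[X]/(F)` REGULAR OFF THE ORIGIN `v` (`hreg`);
a monomial centre `I_A = 𝔪·K_A` (pure powers in `A` and `K_A`) with unimodular charts `V_c` (vertices `m_c`, dual-basis neighbours, Rees cover certificate) on each of which EVERY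
`θ_{V_c} F_l = Y^{d_{c,l}}·g_{c,l}` has `g_{c,l}(0) ≠ 0` (the fan refines all the dual Newton fans).
* §1 `affineBlowup_fullCl_over_of_geomCINondegenerate` — every stalk of `Bl_{I_A} X` OVER THE ORIGIN is FULL (✓`CIEnginePrime.ciCertificates_of_isPrime` with (A3)'s `hon'`, then
  ✓`PointFixableOfCert.affineBlowup_fiClause_over_of_cert`);
* §2 `affineBlowup_fullCl_of_geomCINondegenerate` — EVERY stalk is FULL (off the origin `X` is regular and the blowing up a local isomorphism);
* §3 ★★★ `fHalfRow_CI_of_tables` — for EVERY blowing up `g : S′ → Spec 𝒪_{X,v}` along the POINT FLOOR there is `𝓚 ≠ ⊥` on `S′` supported over the closed point all of whose blowings up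
  are FULL at every stalk (✓`FHalfRowOfProductCentre.fHalfConclusion_of_affineBlowup_mul`).
For `r = 1` these are ✓ `FHalfRowAnyField.*`. The interface question (which toric data a CI class needs class-wide: `F108ConsumableCI`, or ✓`F108Consumable` for equal-support tuples) is
(A4b), not this file. [cite: IshiiSingularities2018, Thm. 4.4.23, Lemma 4.4.24, Cor. 4.4.25] [cite: CuetoPopescupampuStepanov2023, Def. 4.2] [cite: GortzWedhorn2020, Prop. 13.91 and (13.19)]
[cite: StacksProject, Tag 0804 and Tag 080A]
-/

-- single-problem summit: the doubled namespace component is forced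
set_option linter.dupNamespace false

noncomputable section

open AlgebraicGeometry CategoryTheory Literature.AlgebraicGeometry.Resolution TopologicalSpace IsLocalRing MvPolynomial

namespace Summit.ResolutionOfSingularities.ResolutionOfSingularities.Theorems.FInjectiveMacaulayfication.CIClassRow

open Summit.ResolutionOfSingularities.ResolutionOfSingularities.Theorems.FInjectiveMacaulayfication
open Literature.AlgebraicGeometry.Resolution.BoubakriGreuelMarkwig CINondegenerate SliceableCentre

variable (p : ℕ) [Fact p.Prime] (k : Type) [Field k] [CharP k p] (K : Type) [Field K] [Algebra k K] [IsAlgClosed K] {n r : ℕ}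

/-! ## §1 Over the origin -/

set_option maxHeartbeats 800000 in
-- the engine's binder block is large; instantiation is by name
/-- ★★ **EVERY STALK OF `Bl_{I_A} X` OVER THE ORIGIN IS FULL** for a prime, geometrically CI-non-degenerate complete intersection `X = V(F₀, …, F_{r−1})` and a toric cover refining all the
dual Newton fans: ✓`CIEnginePrime.ciCertificates_of_isPrime` with `hon' := CINewtonChartHon.hon_of_geomCINondegenerate`, then ✓`PointFixableOfCert.affineBlowup_fiClause_over_of_cert`.
[OURS; cite: IshiiSingularities2018, Lemma 4.4.24; StacksProject, Tag 0804] -/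
theorem affineBlowup_fullCl_over_of_geomCINondegenerate (Fs : Fin r → MvPolynomial (Fin n) k) (hprime : (Ideal.span (Set.range Fs)).IsPrime)
    (hND : ∀ w : Fin n → ℝ, (∀ i, 0 < w i) →
      IsCINondegenerateAlong w (fun l => ((map (algebraMap k K) (Fs l) : MvPolynomial (Fin n) K) : MvPowerSeries (Fin n) K)))
    (hXne : ∀ v : Fin n, Ideal.Quotient.mk (Ideal.span (Set.range Fs)) (X v) ≠ 0)
    (A : Finset (Fin n →₀ ℕ)) (hprim : ∀ j ∈ (Finset.univ : Finset (Fin n)), ∃ N : ℕ, Finsupp.single j N ∈ A)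
    (t : ℕ) (m : Fin t → (Fin n →₀ ℕ))
    (hcov : ∀ a ∈ A, ∃ (c : Fin t) (K : ℕ), 1 ≤ K ∧ ∃ y ∈ (Ideal.span ((fun b : Fin n →₀ ℕ => (MvPolynomial.monomial b (1 : k) : MvPolynomial (Fin n) k)) '' (A : Set (Fin n →₀ ℕ)))) ^ (K - 1),
      (MvPolynomial.monomial a (1 : k) : MvPolynomial (Fin n) k) ^ K = MvPolynomial.monomial (m c) 1 * y)
    (V : Fin t → Matrix (Fin n) (Fin n) ℕ) (hV : ∀ c, IsUnit ((V c).map (Nat.cast : ℕ → ℤ)).det)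
    (a : Fin t → Fin n → (Fin n →₀ ℕ)) (haA : ∀ c i, a c i ∈ A)
    (hgen : ∀ (c : Fin t) (i : Fin n), (Finsupp.equivFunOnFinite.symm ((V c).mulVec ⇑(a c i)) : Fin n →₀ ℕ) =
      Finsupp.equivFunOnFinite.symm ((V c).mulVec ⇑(m c)) + Finsupp.single i 1)
    (hge : ∀ (c : Fin t), ∀ e ∈ A, (Finsupp.equivFunOnFinite.symm ((V c).mulVec ⇑(m c)) : Fin n →₀ ℕ) ≤ Finsupp.equivFunOnFinite.symm ((V c).mulVec ⇑e))
    (gs : Fin t → Fin r → MvPolynomial (Fin n) k) (d : Fin t → Fin r → (Fin n →₀ ℕ))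
    (hθ : ∀ c l, aeval (fun j : Fin n => ∏ i : Fin n, (X i : MvPolynomial (Fin n) k) ^ V c i j) (Fs l) = monomial (d c l) 1 * gs c l)
    (hg0 : ∀ c l, constantCoeff (gs c l) ≠ 0)
    (hv : ∀ c : Fin t, Ideal.Quotient.mk (Ideal.span (Set.range Fs)) (monomial (m c) (1 : k)) ∈
      Ideal.span ((fun e : Fin n →₀ ℕ => Ideal.Quotient.mk (Ideal.span (Set.range Fs)) (monomial e (1 : k))) '' (A : Set (Fin n →₀ ℕ)))) :
    ∀ y : ↥(affineBlowup (Ideal.span ((fun e : Fin n →₀ ℕ => Ideal.Quotient.mk (Ideal.span (Set.range Fs)) (monomial e (1 : k))) '' (A : Set (Fin n →₀ ℕ))))),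
      Ideal.span ((fun e : Fin n →₀ ℕ => Ideal.Quotient.mk (Ideal.span (Set.range Fs)) (monomial e (1 : k))) '' (A : Set (Fin n →₀ ℕ))) ≤
        ((affineBlowup.π (Ideal.span ((fun e : Fin n →₀ ℕ => Ideal.Quotient.mk (Ideal.span (Set.range Fs)) (monomial e (1 : k))) '' (A : Set (Fin n →₀ ℕ))))).base y).asIdeal →
      FullCl p ((affineBlowup (Ideal.span ((fun e : Fin n →₀ ℕ => Ideal.Quotient.mk (Ideal.span (Set.range Fs)) (monomial e (1 : k))) '' (A : Set (Fin n →₀ ℕ))))).presheaf.stalk y) := by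
  classical
  haveI := hprime
  haveI : IsDomain (MvPolynomial (Fin n) k ⧸ Ideal.span (Set.range Fs)) := Ideal.Quotient.isDomain _
  haveI : CharP (MvPolynomial (Fin n) k ⧸ Ideal.span (Set.range Fs)) p :=
    charP_of_injective_algebraMap (algebraMap k _).injective p
  obtain ⟨hcovR, hv0, hon'⟩ := CICertificates.ciCertificates_of_isPrime p k Finset.univ A hprim t m hcov V hV a haA hgen hge Fs hprime hXne gs d hθ
    (CINewtonChartHon.hon_of_geomCINondegenerate K p Fs hND t V hV gs d hθ hg0) hv
  intro y hy
  exact PointFixableOfCert.affineBlowup_fiClause_over_of_cert p _ _ t _ hv hcovR hv0 hon' y hy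

/-! ## §2 Everywhere -/

set_option maxHeartbeats 800000 in
-- one blow-up-is-iso transport
/-- ★★ **EVERY STALK OF `Bl_{I_A} X` IS FULL**: over the origin by §1; elsewhere `X` is regular (`hreg`) and the blowing up is a local isomorphism over the complement of
`V(I_A) = {origin}`. [OURS; cite: GortzWedhorn2020, Prop. 13.91; StacksProject, Tag 0804] -/
theorem affineBlowup_fullCl_of_geomCINondegenerate (Fs : Fin r → MvPolynomial (Fin n) k) (hprime : (Ideal.span (Set.range Fs)).IsPrime)
    (hND : ∀ w : Fin n → ℝ, (∀ i, 0 < w i) →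
      IsCINondegenerateAlong w (fun l => ((map (algebraMap k K) (Fs l) : MvPolynomial (Fin n) K) : MvPowerSeries (Fin n) K)))
    (hXne : ∀ v : Fin n, Ideal.Quotient.mk (Ideal.span (Set.range Fs)) (X v) ≠ 0)
    (hreg : ∀ x : Spec (.of (MvPolynomial (Fin n) k ⧸ Ideal.span (Set.range Fs))),
      ¬ Ideal.span (Set.range fun j : Fin n => Ideal.Quotient.mk (Ideal.span (Set.range Fs)) (X j)) ≤ x.asIdeal → IsRegularLocalRing (Localization.AtPrime x.asIdeal))
    (A : Finset (Fin n →₀ ℕ)) (hprim : ∀ j ∈ (Finset.univ : Finset (Fin n)), ∃ N : ℕ, Finsupp.single j N ∈ A)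
    (hAJ : ∀ a ∈ A, ∃ j ∈ (Finset.univ : Finset (Fin n)), 0 < a j)
    (t : ℕ) (m : Fin t → (Fin n →₀ ℕ))
    (hcov : ∀ a ∈ A, ∃ (c : Fin t) (K : ℕ), 1 ≤ K ∧ ∃ y ∈ (Ideal.span ((fun b : Fin n →₀ ℕ => (MvPolynomial.monomial b (1 : k) : MvPolynomial (Fin n) k)) '' (A : Set (Fin n →₀ ℕ)))) ^ (K - 1),
      (MvPolynomial.monomial a (1 : k) : MvPolynomial (Fin n) k) ^ K = MvPolynomial.monomial (m c) 1 * y)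
    (V : Fin t → Matrix (Fin n) (Fin n) ℕ) (hV : ∀ c, IsUnit ((V c).map (Nat.cast : ℕ → ℤ)).det)
    (a : Fin t → Fin n → (Fin n →₀ ℕ)) (haA : ∀ c i, a c i ∈ A)
    (hgen : ∀ (c : Fin t) (i : Fin n), (Finsupp.equivFunOnFinite.symm ((V c).mulVec ⇑(a c i)) : Fin n →₀ ℕ) =
      Finsupp.equivFunOnFinite.symm ((V c).mulVec ⇑(m c)) + Finsupp.single i 1)
    (hge : ∀ (c : Fin t), ∀ e ∈ A, (Finsupp.equivFunOnFinite.symm ((V c).mulVec ⇑(m c)) : Fin n →₀ ℕ) ≤ Finsupp.equivFunOnFinite.symm ((V c).mulVec ⇑e))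
    (gs : Fin t → Fin r → MvPolynomial (Fin n) k) (d : Fin t → Fin r → (Fin n →₀ ℕ))
    (hθ : ∀ c l, aeval (fun j : Fin n => ∏ i : Fin n, (X i : MvPolynomial (Fin n) k) ^ V c i j) (Fs l) = monomial (d c l) 1 * gs c l)
    (hg0 : ∀ c l, constantCoeff (gs c l) ≠ 0)
    (hv : ∀ c : Fin t, Ideal.Quotient.mk (Ideal.span (Set.range Fs)) (monomial (m c) (1 : k)) ∈
      Ideal.span ((fun e : Fin n →₀ ℕ => Ideal.Quotient.mk (Ideal.span (Set.range Fs)) (monomial e (1 : k))) '' (A : Set (Fin n →₀ ℕ)))) :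
    ∀ y : ↥(affineBlowup (Ideal.span ((fun e : Fin n →₀ ℕ => Ideal.Quotient.mk (Ideal.span (Set.range Fs)) (monomial e (1 : k))) '' (A : Set (Fin n →₀ ℕ))))),
      FullCl p ((affineBlowup (Ideal.span ((fun e : Fin n →₀ ℕ => Ideal.Quotient.mk (Ideal.span (Set.range Fs)) (monomial e (1 : k))) '' (A : Set (Fin n →₀ ℕ))))).presheaf.stalk y) := by
  classical
  have hover := affineBlowup_fullCl_over_of_geomCINondegenerate p k K Fs hprime hND hXne A hprim t m hcov V hV a haA hgen hge gs d hθ hg0 hv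
  haveI := hprime
  haveI : IsDomain (MvPolynomial (Fin n) k ⧸ Ideal.span (Set.range Fs)) := Ideal.Quotient.isDomain _
  set I : Ideal (MvPolynomial (Fin n) k ⧸ Ideal.span (Set.range Fs)) :=
    Ideal.span ((fun e : Fin n →₀ ℕ => Ideal.Quotient.mk (Ideal.span (Set.range Fs)) (monomial e (1 : k))) '' (A : Set (Fin n →₀ ℕ))) with hI
  intro y
  by_cases hy : I ≤ ((affineBlowup.π I).base y).asIdeal
  · exact hover y hy
  · -- off the origin: `X` regular there and `π` an isomorphism over the complement of `V(I) = {origin}`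
    have hvert : ¬ Ideal.span (Set.range fun j : Fin n => Ideal.Quotient.mk (Ideal.span (Set.range Fs)) (X j)) ≤ ((affineBlowup.π I).base y).asIdeal := by
      intro hle
      exact hy ((CICertificates.centre_le_iff (Ideal.span (Set.range Fs)) Finset.univ A hAJ hprim _).mpr fun j _ => hle (Ideal.subset_span ⟨j, rfl⟩))
    have hregy : (affineBlowup.π I).base y ∈ Scheme.regularLocus (Spec (.of (MvPolynomial (Fin n) k ⧸ Ideal.span (Set.range Fs)))) :=
      FermatCubicConeGerm.mem_regularLocus_Spec_of_isRegularLocalRing _ (hreg _ hvert)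
    have hsupp : (affineBlowup.π I).base y ∉ ((affineBlowup.idealSheaf I).support : Set (Spec (.of (MvPolynomial (Fin n) k ⧸ Ideal.span (Set.range Fs))))) := by
      rw [affineBlowup.support_idealSheaf]
      exact fun h => hy fun r hr => h hr
    haveI := (affineBlowup.isBlowup I).isIso_compl
    let U : (Spec (.of (MvPolynomial (Fin n) k ⧸ Ideal.span (Set.range Fs)))).Opens :=
      ⟨((affineBlowup.idealSheaf I).support : Set (Spec (.of (MvPolynomial (Fin n) k ⧸ Ideal.span (Set.range Fs)))))ᶜ,
        (affineBlowup.idealSheaf I).support.isClosed.isOpen_compl⟩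
    have hyU : (affineBlowup.π I).base y ∈ U := hsupp
    have hreg' : y ∈ Scheme.regularLocus (affineBlowup I) :=
      (mem_regularLocus_iff_of_isIso_morphismRestrict (affineBlowup.π I) U y hyU).mpr hregy
    rw [Scheme.mem_regularLocus] at hreg'
    haveI := hreg'
    haveI := FTemkinClosedPoints.charP_stalk_of_over p
      (Spec.map (CommRingCat.ofHom (algebraMap k (MvPolynomial (Fin n) k ⧸ Ideal.span (Set.range Fs))))) (affineBlowup.π I) y
    exact FTemkinClosedPoints.fullCl_of_isRegularLocalRing p _

/-! ## §3 ★★★ The CI class row: the point floor is CURED -/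

set_option maxHeartbeats 800000 in
-- one product rewrite + the row export
/-- ★★★ **THE CI CLASS ROW (tables form), ANY FIELD OF CHARACTERISTIC `p`.** `k` ANY field of characteristic `p`, `K ⊇ k` algebraically closed; `F₀..F_{r−1} ∈ k[X_0..X_{n−1}]`
(`n ≥ 1`) generating a PRIME ideal, GEOMETRICALLY CI-Newton-non-degenerate along every positive weight, `x̄ᵢ ≠ 0`, `X = Spec k[X]/(F)` regular off the origin `v`; toric cover data for a
monomial centre `I_A = 𝔪·K_A` refining all the dual Newton fans. THEN **for EVERY blowing up `g : S′ → Spec 𝒪_{X,v}` along the POINT FLOOR there is `𝓚 ≠ ⊥` on `S′`, supported over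
the closed point, such that EVERY blowing up of `S′` along `𝓚` is FULL AT EVERY STALK** — the F-half's conclusion for the first NON-HYPERSURFACE class. (`r`-general twin of
✓`FHalfRowAnyField.fHalfRow_of_geomWeaklyNondegenerate`.) [OURS · assembly; cite: IshiiSingularities2018, Thm. 4.4.23 and Cor. 4.4.25; CuetoPopescupampuStepanov2023, Def. 4.2;
GortzWedhorn2020, Prop. 13.92 and (13.19); StacksProject, Tag 080A] -/
theorem fHalfRow_CI_of_tables (hn : 0 < n) (Fs : Fin r → MvPolynomial (Fin n) k) (hprime : (Ideal.span (Set.range Fs)).IsPrime)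
    (hND : ∀ w : Fin n → ℝ, (∀ i, 0 < w i) →
      IsCINondegenerateAlong w (fun l => ((map (algebraMap k K) (Fs l) : MvPolynomial (Fin n) K) : MvPowerSeries (Fin n) K)))
    (hXne : ∀ v : Fin n, Ideal.Quotient.mk (Ideal.span (Set.range Fs)) (X v) ≠ 0)
    (hreg : ∀ x : Spec (.of (MvPolynomial (Fin n) k ⧸ Ideal.span (Set.range Fs))),
      ¬ Ideal.span (Set.range fun j : Fin n => Ideal.Quotient.mk (Ideal.span (Set.range Fs)) (X j)) ≤ x.asIdeal → IsRegularLocalRing (Localization.AtPrime x.asIdeal))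
    (A KA : Finset (Fin n →₀ ℕ))
    (hIA : Ideal.span ((fun e : Fin n →₀ ℕ => Ideal.Quotient.mk (Ideal.span (Set.range Fs)) (monomial e (1 : k))) '' (A : Set (Fin n →₀ ℕ))) =
      Ideal.span (Set.range fun j : Fin n => Ideal.Quotient.mk (Ideal.span (Set.range Fs)) (X j)) *
        Ideal.span ((fun e : Fin n →₀ ℕ => Ideal.Quotient.mk (Ideal.span (Set.range Fs)) (monomial e (1 : k))) '' (KA : Set (Fin n →₀ ℕ))))
    (hKprim : ∀ j : Fin n, ∃ N : ℕ, Finsupp.single j N ∈ KA)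
    (hprim : ∀ j ∈ (Finset.univ : Finset (Fin n)), ∃ N : ℕ, Finsupp.single j N ∈ A)
    (hAJ : ∀ a ∈ A, ∃ j ∈ (Finset.univ : Finset (Fin n)), 0 < a j)
    (t : ℕ) (m : Fin t → (Fin n →₀ ℕ))
    (hcov : ∀ a ∈ A, ∃ (c : Fin t) (K : ℕ), 1 ≤ K ∧ ∃ y ∈ (Ideal.span ((fun b : Fin n →₀ ℕ => (MvPolynomial.monomial b (1 : k) : MvPolynomial (Fin n) k)) '' (A : Set (Fin n →₀ ℕ)))) ^ (K - 1),
      (MvPolynomial.monomial a (1 : k) : MvPolynomial (Fin n) k) ^ K = MvPolynomial.monomial (m c) 1 * y)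
    (V : Fin t → Matrix (Fin n) (Fin n) ℕ) (hV : ∀ c, IsUnit ((V c).map (Nat.cast : ℕ → ℤ)).det)
    (a : Fin t → Fin n → (Fin n →₀ ℕ)) (haA : ∀ c i, a c i ∈ A)
    (hgen : ∀ (c : Fin t) (i : Fin n), (Finsupp.equivFunOnFinite.symm ((V c).mulVec ⇑(a c i)) : Fin n →₀ ℕ) =
      Finsupp.equivFunOnFinite.symm ((V c).mulVec ⇑(m c)) + Finsupp.single i 1)
    (hge : ∀ (c : Fin t), ∀ e ∈ A, (Finsupp.equivFunOnFinite.symm ((V c).mulVec ⇑(m c)) : Fin n →₀ ℕ) ≤ Finsupp.equivFunOnFinite.symm ((V c).mulVec ⇑e))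
    (gs : Fin t → Fin r → MvPolynomial (Fin n) k) (d : Fin t → Fin r → (Fin n →₀ ℕ))
    (hθ : ∀ c l, aeval (fun j : Fin n => ∏ i : Fin n, (X i : MvPolynomial (Fin n) k) ^ V c i j) (Fs l) = monomial (d c l) 1 * gs c l)
    (hg0 : ∀ c l, constantCoeff (gs c l) ≠ 0)
    (hv : ∀ c : Fin t, Ideal.Quotient.mk (Ideal.span (Set.range Fs)) (monomial (m c) (1 : k)) ∈
      Ideal.span ((fun e : Fin n →₀ ℕ => Ideal.Quotient.mk (Ideal.span (Set.range Fs)) (monomial e (1 : k))) '' (A : Set (Fin n →₀ ℕ))))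
    (v : Spec (.of (MvPolynomial (Fin n) k ⧸ Ideal.span (Set.range Fs))))
    (hvm : v.asIdeal = Ideal.span (Set.range fun j : Fin n => Ideal.Quotient.mk (Ideal.span (Set.range Fs)) (X j))) :
    ∀ (S' : Scheme.{0}) (gS : S' ⟶ Spec ((Spec (.of (MvPolynomial (Fin n) k ⧸ Ideal.span (Set.range Fs)))).presheaf.stalk v)),
      IsBlowup gS ((affineBlowup.idealSheaf (Ideal.span (Set.range fun j : Fin n => Ideal.Quotient.mk (Ideal.span (Set.range Fs)) (X j)))).comap
        ((Spec (.of (MvPolynomial (Fin n) k ⧸ Ideal.span (Set.range Fs)))).fromSpecStalk v)) →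
      ∃ 𝓚 : S'.IdealSheafData, 𝓚 ≠ ⊥ ∧
        (∀ s ∈ (𝓚.support : Set S'), gS.base s = closedPoint ((Spec (.of (MvPolynomial (Fin n) k ⧸ Ideal.span (Set.range Fs)))).presheaf.stalk v)) ∧
        ∀ (S'' : Scheme.{0}) (π : S'' ⟶ S'), IsBlowup π 𝓚 → ∀ s : S'', FullCl p (S''.presheaf.stalk s) := by
  classical
  haveI := hprime
  haveI : IsDomain (MvPolynomial (Fin n) k ⧸ Ideal.span (Set.range Fs)) := Ideal.Quotient.isDomain _
  have hmono : ∀ e : Fin n →₀ ℕ, Ideal.Quotient.mk (Ideal.span (Set.range Fs)) (monomial e (1 : k)) ≠ 0 := fun e =>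
    CIConeFiModelCore.mk_monomial_ne_zero (Ideal.span (Set.range Fs)) hXne e
  -- `τ = 𝔪 ≠ ⊥`, `K ≠ ⊥`, `v ⊆ √K`
  have hτ : Ideal.span (Set.range fun j : Fin n => Ideal.Quotient.mk (Ideal.span (Set.range Fs)) (X j)) ≠ ⊥ := fun h0 =>
    hXne ⟨0, hn⟩ ((Submodule.eq_bot_iff _).mp h0 _ (Ideal.subset_span ⟨⟨0, hn⟩, rfl⟩))
  have hK : Ideal.span ((fun e : Fin n →₀ ℕ => Ideal.Quotient.mk (Ideal.span (Set.range Fs)) (monomial e (1 : k))) '' (KA : Set (Fin n →₀ ℕ))) ≠ ⊥ := by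
    intro h0
    obtain ⟨N, hN⟩ := hKprim ⟨0, hn⟩
    exact hmono _ ((Submodule.eq_bot_iff _).mp h0 _ (Ideal.subset_span ⟨_, hN, rfl⟩))
  have hvK : v.asIdeal ≤ (Ideal.span ((fun e : Fin n →₀ ℕ => Ideal.Quotient.mk (Ideal.span (Set.range Fs)) (monomial e (1 : k))) '' (KA : Set (Fin n →₀ ℕ)))).radical := by
    rw [hvm, Ideal.span_le]
    rintro _ ⟨j, rfl⟩
    obtain ⟨N, hN⟩ := hKprim j
    exact ⟨N, by rw [← map_pow, X_pow_eq_monomial]; exact Ideal.subset_span ⟨_, hN, rfl⟩⟩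
  have hrow : ∀ y : ↥(affineBlowup (Ideal.span (Set.range fun j : Fin n => Ideal.Quotient.mk (Ideal.span (Set.range Fs)) (X j)) *
      Ideal.span ((fun e : Fin n →₀ ℕ => Ideal.Quotient.mk (Ideal.span (Set.range Fs)) (monomial e (1 : k))) '' (KA : Set (Fin n →₀ ℕ))))),
      FullCl p ((affineBlowup (Ideal.span (Set.range fun j : Fin n => Ideal.Quotient.mk (Ideal.span (Set.range Fs)) (X j)) *
        Ideal.span ((fun e : Fin n →₀ ℕ => Ideal.Quotient.mk (Ideal.span (Set.range Fs)) (monomial e (1 : k))) '' (KA : Set (Fin n →₀ ℕ))))).presheaf.stalk y) := by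
    rw [← hIA]
    exact affineBlowup_fullCl_of_geomCINondegenerate p k K Fs hprime hND hXne hreg A hprim hAJ t m hcov V hV a haA hgen hge gs d hθ hg0 hv
  exact FHalfRowOfProductCentre.fHalfConclusion_of_affineBlowup_mul p _ _ hτ hK v hvK hrow

end Summit.ResolutionOfSingularities.ResolutionOfSingularities.Theorems.FInjectiveMacaulayfication.CIClassRow

end
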